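import Mathlib
import Summits.ValiantsHypothesis.ValiantsHypothesis.Theorems.KPlusLogSqLawWeakLiftingTowerGraftSectorFreeGraft

/-!
# Tower graft line — ROOT SUMS AND THEIR LOG-SLOPES (machinery for T1 with in-sector real events)

Mechanism file for the line `Cruxes/WeakLifting/Lines/tower_graft.lean` (crux `WeakLifting` = stmt-ValiantsHypothesis-19561,
memo `tower_graft-S5.md` §3 T1 «log-slope localisation»); companion of `…TowerGraftSectorFreeGraft.lean` (sector-free digits ⇒
one crossing).  NO stub is claimed; this file is pure real/complex analysis of ROOT SUMS, consumed by the next file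
(`…TowerGraftRealEvents.lean`: one-sided in-sector REAL events cost two crossings each).

CONTENT (def-free; `s` plays `sin ω`, «off the sector» is `s·‖z‖ ≤ |Im z| ∨ Re z ≤ 0`).
§1 Geometry: an off-sector point is also at distance `≥ s·‖z‖` from every `t ≥ 0` (`mul_norm_le_norm_sub_of_offSector`), hence the
   first- and second-order TERM BOUNDS `‖t/(t − z)‖ ≤ 1/s` and `‖z·t/(t − z)²‖ ≤ 1/s²` (`norm_div_sub_le_of_offSector`,
   `norm_mul_div_sub_sq_le_of_offSector`).
§2 Root sums `S_m(t) = Σ_{z ∈ m} t/(t − z)` of a multiset `m ⊂ ℂ` along the real axis: `HasDerivAt` with derivative `Σ −z/(t − z)²`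
   (`hasDerivAt_rootSum`, `hasDerivAt_rootSum_re`), and the bounds `|Re S_m(t)| ≤ card m / s`, `|t · Re S_m′(t)| ≤ card m / s²` when
   every element of `m` is off-sector (`abs_rootSum_re_le`, `abs_mul_rootSumDeriv_re_le`).
§3 The log-slope of a real polynomial IS the root sum over its complex roots: `t·A′(t)/A(t) = Re S_{roots A}(t)` wherever `A(t) ≠ 0`
   (`mul_logDeriv_eq_rootSum_re`, from Mathlib's `Splits.eval_derivative_div_eval_of_ne_zero`), so `t ↦ t·A′/A` has derivative
   `Re Σ_z −z/(t − z)²` there (`hasDerivAt_mul_logDeriv`).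
§4 Cauchy–Schwarz for multisets of reals, `(Σ x)² ≤ card · Σ x²` (`sq_sum_le_card_mul_sum_sq_multiset`) — the convexity input that makes
   a cluster of `k` real spikes of total height `Y` carry curvature `≥ Y²/k − Y`.
HONEST FRAMING: elementary analysis; nothing on S4/S4b/S5, TowerB, `WeakLifting`, Conjecture B, `MatrixDescartes` (18050) or
`VP ≠ VNP`.  Seat: prover val-sym-lift-p1 g20, `--supports stmt-ValiantsHypothesis-19561`.
-/

-- `Summit.ValiantsHypothesis.ValiantsHypothesis.…` repeats a component by the D-0017 layout
-- (single-conjunct summit), which the `dupNamespace` linter flags; the name is mandated.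
set_option linter.dupNamespace false

namespace Summit.ValiantsHypothesis.ValiantsHypothesis.Theorems.KPlusLogSqLaw.TowerGraft

open Polynomial
open scoped BigOperators Polynomial

/-! ## §1 Off-sector geometry, second bound, and the term bounds -/

section Geometry

/-- an off-sector point `z` (`s·‖z‖ ≤ |Im z| ∨ Re z ≤ 0`, `0 ≤ s ≤ 1`) is at distance `≥ s·‖z‖` from every real `t ≥ 0`. [folklore] -/
theorem mul_norm_le_norm_sub_of_offSector {s : ℝ} (hs1 : s ≤ 1) {t : ℝ} (ht : 0 ≤ t) {z : ℂ}
    (hz : s * ‖z‖ ≤ |z.im| ∨ z.re ≤ 0) : s * ‖z‖ ≤ ‖(t : ℂ) - z‖ := by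
  rcases hz with hz | hz
  · calc s * ‖z‖ ≤ |z.im| := hz
      _ = |((t : ℂ) - z).im| := by simp
      _ ≤ ‖(t : ℂ) - z‖ := Complex.abs_im_le_norm _
  · have hnorm : ‖(t : ℂ) - z‖ ^ 2 = (t - z.re) ^ 2 + z.im ^ 2 := by
      rw [Complex.sq_norm, Complex.normSq_apply]
      simp only [Complex.sub_re, Complex.ofReal_re, Complex.sub_im, Complex.ofReal_im, zero_sub]
      ring
    have hz2 : ‖z‖ ^ 2 = z.re ^ 2 + z.im ^ 2 := by
      rw [Complex.sq_norm, Complex.normSq_apply]; ring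
    have h1 : ‖z‖ ^ 2 ≤ ‖(t : ℂ) - z‖ ^ 2 := by
      rw [hnorm, hz2]; nlinarith [mul_nonneg ht (neg_nonneg.mpr hz)]
    have h2 : ‖z‖ ≤ ‖(t : ℂ) - z‖ := by
      have := abs_le_of_sq_le_sq h1 (norm_nonneg _)
      rwa [abs_of_nonneg (norm_nonneg z)] at this
    calc s * ‖z‖ ≤ 1 * ‖z‖ := mul_le_mul_of_nonneg_right hs1 (norm_nonneg z)
      _ ≤ ‖(t : ℂ) - z‖ := by rw [one_mul]; exact h2

/-- **first-order term bound**: `‖t/(t − z)‖ ≤ 1/s` for `t > 0` and `z` off-sector. [folklore] -/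
theorem norm_div_sub_le_of_offSector {s : ℝ} (hs : 0 < s) (hs1 : s ≤ 1) {t : ℝ} (ht : 0 < t) {z : ℂ}
    (hz : s * ‖z‖ ≤ |z.im| ∨ z.re ≤ 0) : ‖(t : ℂ) / ((t : ℂ) - z)‖ ≤ 1 / s := by
  have hdist : t * s ≤ ‖(t : ℂ) - z‖ := mul_le_norm_sub_of_offSector hs.le hs1 ht.le hz
  have hts : 0 < t * s := mul_pos ht hs
  rw [norm_div, Complex.norm_real, Real.norm_eq_abs, abs_of_pos ht]
  calc t / ‖(t : ℂ) - z‖ ≤ t / (t * s) := div_le_div_of_nonneg_left ht.le hts hdist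
    _ = 1 / s := by field_simp

/-- **second-order term bound**: `‖z·t/(t − z)²‖ ≤ 1/s²` for `t > 0` and `z` off-sector (the two distance bounds
`‖t − z‖ ≥ s·t`, `‖t − z‖ ≥ s·‖z‖` multiply). [folklore] -/
theorem norm_mul_div_sub_sq_le_of_offSector {s : ℝ} (hs : 0 < s) (hs1 : s ≤ 1) {t : ℝ} (ht : 0 < t) {z : ℂ}
    (hz : s * ‖z‖ ≤ |z.im| ∨ z.re ≤ 0) : ‖z * (t : ℂ) / ((t : ℂ) - z) ^ 2‖ ≤ 1 / s ^ 2 := by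
  have hd1 : t * s ≤ ‖(t : ℂ) - z‖ := mul_le_norm_sub_of_offSector hs.le hs1 ht.le hz
  have hd2 : s * ‖z‖ ≤ ‖(t : ℂ) - z‖ := mul_norm_le_norm_sub_of_offSector hs1 ht.le hz
  by_cases hz0 : z = 0
  · subst hz0; simp; positivity
  have hzpos : 0 < ‖z‖ := norm_pos_iff.mpr hz0
  have hden : 0 < s * ‖z‖ * (t * s) := by positivity
  have hprod : s * ‖z‖ * (t * s) ≤ ‖(t : ℂ) - z‖ ^ 2 := by
    rw [sq]; exact mul_le_mul hd2 hd1 (by positivity) (norm_nonneg _)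
  rw [norm_div, norm_mul, norm_pow, Complex.norm_real, Real.norm_eq_abs, abs_of_pos ht]
  calc ‖z‖ * t / ‖(t : ℂ) - z‖ ^ 2 ≤ ‖z‖ * t / (s * ‖z‖ * (t * s)) :=
        div_le_div_of_nonneg_left (by positivity) hden hprod
    _ = 1 / s ^ 2 := by field_simp

end Geometry

/-! ## §2 Root sums along the real axis: derivative and bounds -/

section RootSums

/-- derivative of one term `x ↦ x/(x − z)` along the real axis: `−z/(t − z)²`. [folklore] -/
theorem hasDerivAt_div_sub (z : ℂ) {t : ℝ} (ht : (t : ℂ) ≠ z) :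
    HasDerivAt (fun x : ℝ => (x : ℂ) / ((x : ℂ) - z)) (-z / ((t : ℂ) - z) ^ 2) t := by
  have hsub : (t : ℂ) - z ≠ 0 := sub_ne_zero.mpr ht
  have h1 : HasDerivAt (fun w : ℂ => w / (w - z)) (-z / ((t : ℂ) - z) ^ 2) (t : ℂ) := by
    have h := (hasDerivAt_id' (t : ℂ)).div ((hasDerivAt_id' (t : ℂ)).sub_const z) hsub
    refine h.congr_deriv ?_
    rw [div_left_inj' (pow_ne_zero 2 hsub)]
    ring
  exact h1.comp_ofReal

/-- **derivative of a root sum** `x ↦ Σ_{z ∈ m} x/(x − z)` at a real point off the multiset: `Σ_{z ∈ m} −z/(t − z)²`. [folklore] -/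
theorem hasDerivAt_rootSum (m : Multiset ℂ) {t : ℝ} (ht : ∀ z ∈ m, (t : ℂ) ≠ z) :
    HasDerivAt (fun x : ℝ => (m.map fun z => (x : ℂ) / ((x : ℂ) - z)).sum)
      ((m.map fun z => -z / ((t : ℂ) - z) ^ 2).sum) t := by
  classical
  have key : ∀ f : ℂ → ℂ, (m.map f).sum = ∑ z ∈ m.toFinset, (m.count z : ℂ) * f z := by
    intro f
    rw [Finset.sum_multiset_map_count]
    simp [nsmul_eq_mul]
  simp_rw [key]
  refine HasDerivAt.fun_sum fun z hz => ?_
  exact (hasDerivAt_div_sub z (ht z (Multiset.mem_toFinset.mp hz))).const_mul _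

/-- real part of the root-sum derivative. [folklore] -/
theorem hasDerivAt_rootSum_re (m : Multiset ℂ) {t : ℝ} (ht : ∀ z ∈ m, (t : ℂ) ≠ z) :
    HasDerivAt (fun x : ℝ => ((m.map fun z => (x : ℂ) / ((x : ℂ) - z)).sum).re)
      ((m.map fun z => -z / ((t : ℂ) - z) ^ 2).sum).re t := by
  have := Complex.reCLM.hasFDerivAt.comp_hasDerivAt t (hasDerivAt_rootSum m ht)
  simpa [Function.comp_def] using this

/-- an off-sector multiset avoids every positive real (as a complex number). [folklore] -/
theorem ne_of_mem_offSector {s : ℝ} (hs : 0 < s) {t : ℝ} (ht : 0 < t) {m : Multiset ℂ}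
    (hm : ∀ z ∈ m, s * ‖z‖ ≤ |z.im| ∨ z.re ≤ 0) : ∀ z ∈ m, (t : ℂ) ≠ z := by
  intro z hz h
  exact not_offSector_of_pos hs ht (h ▸ hm z hz)

/-- **first-order bound on an off-sector root sum**: `|Re Σ_{z ∈ m} t/(t − z)| ≤ card m / s`. [folklore] -/
theorem abs_rootSum_re_le {s : ℝ} (hs : 0 < s) (hs1 : s ≤ 1) {t : ℝ} (ht : 0 < t) (m : Multiset ℂ)
    (hm : ∀ z ∈ m, s * ‖z‖ ≤ |z.im| ∨ z.re ≤ 0) :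
    |((m.map fun z => (t : ℂ) / ((t : ℂ) - z)).sum).re| ≤ Multiset.card m / s := by
  calc |((m.map fun z => (t : ℂ) / ((t : ℂ) - z)).sum).re|
      ≤ ‖(m.map fun z => (t : ℂ) / ((t : ℂ) - z)).sum‖ := Complex.abs_re_le_norm _
    _ ≤ ((m.map fun z => (t : ℂ) / ((t : ℂ) - z)).map fun x => ‖x‖).sum := norm_multiset_sum_le _
    _ = (m.map fun z => ‖(t : ℂ) / ((t : ℂ) - z)‖).sum := by rw [Multiset.map_map]; rfl
    _ ≤ (m.map fun _ => 1 / s).sum :=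
        Multiset.sum_map_le_sum_map _ _ fun z hz => norm_div_sub_le_of_offSector hs hs1 ht (hm z hz)
    _ = Multiset.card m / s := by
        rw [Multiset.map_const', Multiset.sum_replicate, nsmul_eq_mul, ← div_eq_mul_one_div]

/-- **second-order bound on an off-sector root sum**: `|t · Re Σ_{z ∈ m} −z/(t − z)²| ≤ card m / s²`. [folklore] -/
theorem abs_mul_rootSumDeriv_re_le {s : ℝ} (hs : 0 < s) (hs1 : s ≤ 1) {t : ℝ} (ht : 0 < t) (m : Multiset ℂ)
    (hm : ∀ z ∈ m, s * ‖z‖ ≤ |z.im| ∨ z.re ≤ 0) :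
    |t * ((m.map fun z => -z / ((t : ℂ) - z) ^ 2).sum).re| ≤ Multiset.card m / s ^ 2 := by
  have hmul : t * ((m.map fun z => -z / ((t : ℂ) - z) ^ 2).sum).re =
      ((m.map fun z => -(z * (t : ℂ) / ((t : ℂ) - z) ^ 2)).sum).re := by
    have hmap : (m.map fun z => (t : ℂ) * (-z / ((t : ℂ) - z) ^ 2)) =
        m.map fun z => -(z * (t : ℂ) / ((t : ℂ) - z) ^ 2) := Multiset.map_congr rfl fun z _ => by ring
    rw [← Complex.re_ofReal_mul, ← Multiset.sum_map_mul_left, hmap]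
  rw [hmul]
  calc |((m.map fun z => -(z * (t : ℂ) / ((t : ℂ) - z) ^ 2)).sum).re|
      ≤ ‖(m.map fun z => -(z * (t : ℂ) / ((t : ℂ) - z) ^ 2)).sum‖ := Complex.abs_re_le_norm _
    _ ≤ ((m.map fun z => -(z * (t : ℂ) / ((t : ℂ) - z) ^ 2)).map fun x => ‖x‖).sum := norm_multiset_sum_le _
    _ = (m.map fun z => ‖z * (t : ℂ) / ((t : ℂ) - z) ^ 2‖).sum := by
        rw [Multiset.map_map]
        exact congrArg _ (Multiset.map_congr rfl fun z _ => by simp [norm_neg])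
    _ ≤ (m.map fun _ => 1 / s ^ 2).sum :=
        Multiset.sum_map_le_sum_map _ _ fun z hz => norm_mul_div_sub_sq_le_of_offSector hs hs1 ht (hm z hz)
    _ = Multiset.card m / s ^ 2 := by
        rw [Multiset.map_const', Multiset.sum_replicate, nsmul_eq_mul, ← div_eq_mul_one_div]

end RootSums

/-! ## §3 The log-slope of a real polynomial is the root sum over its complex roots -/

section LogSlope

/-- **`t·A′(t)/A(t) = Re Σ_{z ∈ roots A} t/(t − z)`** at every real `t` with `A(t) ≠ 0` (the complex identity is Mathlib's
`Polynomial.Splits.eval_derivative_div_eval_of_ne_zero`; its value is real). [folklore] -/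
theorem mul_logDeriv_eq_rootSum_re (A : ℝ[X]) {t : ℝ} (hAt : A.eval t ≠ 0) :
    t * (A.derivative.eval t / A.eval t) =
      (((A.map Complex.ofRealHom).roots.map fun z => (t : ℂ) / ((t : ℂ) - z)).sum).re := by
  set Ac : ℂ[X] := A.map Complex.ofRealHom with hAcdef
  have hev : ∀ Q : ℝ[X], (Q.map Complex.ofRealHom).eval (t : ℂ) = ((Q.eval t : ℝ) : ℂ) := fun Q => by
    rw [Polynomial.eval_map, ← Complex.ofRealHom_eq_coe, Polynomial.eval₂_at_apply, Complex.ofRealHom_eq_coe]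
  have hAct : Ac.eval (t : ℂ) ≠ 0 := by
    rw [hAcdef, hev]; exact_mod_cast hAt
  have hsplit : Ac.Splits := IsAlgClosed.splits Ac
  have hform := hsplit.eval_derivative_div_eval_of_ne_zero hAct
  have hder : Ac.derivative.eval (t : ℂ) = ((A.derivative.eval t : ℝ) : ℂ) := by
    rw [hAcdef, Polynomial.derivative_map, hev]
  rw [hder, hAcdef, hev, ← Complex.ofReal_div] at hform
  have hsum : ((t * (A.derivative.eval t / A.eval t) : ℝ) : ℂ) =
      (Ac.roots.map fun z => (t : ℂ) / ((t : ℂ) - z)).sum := by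
    rw [Complex.ofReal_mul, hform, ← Multiset.sum_map_mul_left]
    exact congrArg _ (Multiset.map_congr rfl fun z _ => by rw [← div_eq_mul_one_div])
  rw [← hsum, Complex.ofReal_re]

/-- **derivative of the log-slope**: at a real `t` with `A(t) ≠ 0`, `x ↦ x·A′(x)/A(x)` has derivative
`Re Σ_{z ∈ roots A} −z/(t − z)²` (differentiate the root-sum identity on the open set `{A ≠ 0}`). [folklore] -/
theorem hasDerivAt_mul_logDeriv (A : ℝ[X]) (hA : A ≠ 0) {t : ℝ} (hAt : A.eval t ≠ 0) :
    HasDerivAt (fun x : ℝ => x * (A.derivative.eval x / A.eval x))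
      (((A.map Complex.ofRealHom).roots.map fun z => -z / ((t : ℂ) - z) ^ 2).sum).re t := by
  have hAc : A.map Complex.ofRealHom ≠ 0 := (Polynomial.map_ne_zero_iff Complex.ofRealHom.injective).mpr hA
  -- `t` is not a complex root
  have ht : ∀ z ∈ (A.map Complex.ofRealHom).roots, (t : ℂ) ≠ z := by
    intro z hz h
    rw [Polynomial.mem_roots hAc, Polynomial.IsRoot.def, ← h, Polynomial.eval_map, ← Complex.ofRealHom_eq_coe,
      Polynomial.eval₂_at_apply, Complex.ofRealHom_eq_coe, Complex.ofReal_eq_zero] at hz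
    exact hAt hz
  refine (hasDerivAt_rootSum_re _ ht).congr_of_eventuallyEq ?_
  -- the two functions agree on the open set `{A ≠ 0}` around `t`
  have hopen : IsOpen {x : ℝ | A.eval x ≠ 0} := isOpen_ne_fun A.continuous continuous_const
  filter_upwards [hopen.mem_nhds hAt] with x hx
  exact mul_logDeriv_eq_rootSum_re A hx

end LogSlope

/-! ## §4 Cauchy–Schwarz for a multiset of reals -/

section CauchySchwarz

/-- `2·a·Σ x ≤ card·a² + Σ x²` (termwise `2ab ≤ a² + b²`). [folklore] -/
theorem two_mul_mul_sum_le (a : ℝ) (m : Multiset ℝ) :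
    2 * a * m.sum ≤ Multiset.card m * a ^ 2 + (m.map fun x => x ^ 2).sum := by
  have h1 : 2 * a * m.sum = (m.map fun x => 2 * a * x).sum := by
    rw [Multiset.sum_map_mul_left, Multiset.map_id']
  have h2 : (Multiset.card m : ℝ) * a ^ 2 + (m.map fun x => x ^ 2).sum = (m.map fun x => a ^ 2 + x ^ 2).sum := by
    rw [Multiset.sum_map_add, Multiset.map_const', Multiset.sum_replicate, nsmul_eq_mul]
  rw [h1, h2]
  exact Multiset.sum_map_le_sum_map _ _ fun x _ => by nlinarith [sq_nonneg (a - x)]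

/-- **Cauchy–Schwarz for multisets of reals**: `(Σ x)² ≤ card · Σ x²`. [folklore] -/
theorem sq_sum_le_card_mul_sum_sq_multiset (m : Multiset ℝ) :
    m.sum ^ 2 ≤ Multiset.card m * (m.map fun x => x ^ 2).sum := by
  induction m using Multiset.induction_on with
  | empty => simp
  | cons a m ih =>
    rw [Multiset.sum_cons, Multiset.card_cons, Multiset.map_cons, Multiset.sum_cons]
    have h := two_mul_mul_sum_le a m
    push_cast
    nlinarith [h, ih]

end CauchySchwarz

end Summit.ValiantsHypothesis.ValiantsHypothesis.Theorems.KPlusLogSqLaw.TowerGraft
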